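import Summits.QuantumFields.YangMills.Theorems.BalabanLadderIRColdPurityGaussLawConcentration
import HarnessLib

/-!
# Route `BalabanLadder`, crux `IR` (stmt-QuantumFields-19354): CHECKERBOARD decomposition of the temporal plaquette energy
# under the Gauss law — regrouping by even sites, and the one-site Jensen/Hoeffding sandwich
# (part 3 of the Gauss-law series; part 4 = `BalabanLadderIRColdPurityGaussLawCheckerboardDecoupling.lean`)

Instrument seat `ym-ir-eng-2` (generation g6, transfer-matrix lane), cell `pub/ym-ir` (`--supports stmt-QuantumFields-19354`,
helper; no registered stub is claimed).  Parts 1–2 (`…GaussLawConcentration`, `…GaussLawDecoupling`) bounded the Gauss-law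
factor `I_β(U,V) = ∫ e^{−βS_tm(U,g,V)} dg` between `e^{−βS̄}` and `e^{−βS̄}·e^{(9/2)n²β²L⁶}` by treating `S_tm ∈ [0,6nL³]`
as ONE bounded random variable.  Here the `L⁶` becomes `L³` by INDEPENDENCE: every temporal plaquette `{x, x+eᵢ}` joins
one even and one odd site of a bipartition `p` of `(ℤ/L)³` (for even `L`: checkerboard parity, `parity_shift_iff`), so
CONDITIONALLY ON THE ODD LINKS the energy `S_tm` is a sum over even sites `y` of terms `F_y` depending on the single
link `g_y` (`sliceTemporalAction_eq_sum_even`), each a sum of `f_y ≤ 6` plaquette terms (`card_fiber_le_six`,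
`Σ_y f_y² ≤ 18L³`: `sum_card_fiber_sq_le`), each plaquette term with Haar mean `s̄₀ = n − ∫ Re tr ρ` WHATEVER the odd
link, the slices and the orientation (`plaquetteTerm_facts`, by one-link translation/inversion invariance), hence
(`siteTerm_two_sided`, Jensen below and Hoeffding above on ONE copy of `G`):
`e^{−β f_y s̄₀} ≤ ∫ e^{−β F_y(a)} da ≤ e^{−β f_y s̄₀}·e^{n² f_y² β²/2}`.
THEOREMS ONLY — no `def` (the even-endpoint map, the fibres and the site terms are written as explicit terms), no named
fact, no `instance`.  Part 4 multiplies the site terms (Fubini on the even product space) and integrates the odd links.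

HONEST FRAMING.  Small-`β` bookkeeping for ONE finite torus, group-blind (`U(1)` obeys it verbatim), width 0 toward `PX` /
`PXcof` (β → ∞ objects); `BalabanLadder.IR` / `.IRcof` are NOT closed (0/1); the Yang–Mills mass gap (Clay) is NOT proved
by any of this; R4 closes only the conditional finite-𝕋⁴ rung `BalabanLadder.UV`.
-/

noncomputable section

open MeasureTheory Filter Function Finset
open Literature.MathematicalPhysics.QuantumFieldTheory

namespace Summit.QuantumFields.YangMills.Cruxes.IR.ColdPurityGaussLaw

/-! ## §1 Bipartitions of the spatial torus and the even-endpoint fibres -/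

section Bipartite

variable {L : ℕ}

/-- **Checkerboard parity flips along every lattice direction when the side is even**: with
`π(x) = Σ_j (x_j mod 2) ∈ ZMod 2` (well defined for `2 ∣ L`), `π(x + eᵢ) = π(x) + 1`, so the predicate `π(x) = 1` ("odd
site") satisfies `odd(x + eᵢ) ↔ ¬ odd(x)`. [folklore] -/
theorem parity_shift_iff (h2 : 2 ∣ L) (x : Site 3 L) (i : Fin 3) :
    (∑ j, ZMod.castHom h2 (ZMod 2) ((x.shift i) j)) = 1 ↔ ¬ (∑ j, ZMod.castHom h2 (ZMod 2) (x j)) = 1 := by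
  have hsum : (∑ j, ZMod.castHom h2 (ZMod 2) ((x.shift i) j)) = (∑ j, ZMod.castHom h2 (ZMod 2) (x j)) + 1 := by
    simp only [Site.shift, Pi.add_apply, map_add, Finset.sum_add_distrib, add_right_inj]
    rw [Finset.sum_eq_single i (fun j _ hj => by rw [Pi.single_eq_of_ne hj, map_zero])
      (fun h => absurd (Finset.mem_univ i) h), Pi.single_eq_same, map_one]
  rw [hsum]
  have key : ∀ a : ZMod 2, a + 1 = 1 ↔ ¬ a = 1 := by decide
  exact key _

variable (p : Site 3 L → Prop) [DecidablePred p]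

/-- For a bipartition `p` of the sites (`p(x + eᵢ) ↔ ¬p(x)`): the "even" (`¬p`) endpoint of the temporal plaquette
`(x, i)` — `x` itself if `¬p x`, else `x + eᵢ`.  Plumbing for the checkerboard decomposition; stated as a term so that no
definition is introduced. [folklore] -/
theorem exists_evenEnd (hp : ∀ x i, p (x.shift i) ↔ ¬ p x) (P : Edge 3 L) :
    ¬ p (if p P.1 then P.1.shift P.2 else P.1) := by
  by_cases h : p P.1
  · rw [if_pos h]; exact fun h' => (hp P.1 P.2).1 h' h
  · rw [if_neg h]; exact h

variable [NeZero L]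

/-- The fiber of an even site `y` under the even-endpoint map has at most `6` plaquettes: those based at `y` and those
based at `y − eᵢ`. [folklore] -/
theorem card_fiber_le_six (y : Site 3 L) :
    #{P : Edge 3 L | (if p P.1 then P.1.shift P.2 else P.1) = y} ≤ 6 := by
  classical
  have hsub : ({P : Edge 3 L | (if p P.1 then P.1.shift P.2 else P.1) = y} : Finset (Edge 3 L)) ⊆
      (univ.image fun i : Fin 3 => (y, i)) ∪ (univ.image fun i : Fin 3 => (y - Pi.single i 1, i)) := by
    intro P hP
    rw [mem_filter] at hP
    obtain ⟨-, hP⟩ := hP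
    rw [Finset.mem_union, Finset.mem_image, Finset.mem_image]
    by_cases h : p P.1
    · rw [if_pos h] at hP
      right
      refine ⟨P.2, mem_univ _, ?_⟩
      rw [← hP]
      ext <;> simp [Site.shift]
    · rw [if_neg h] at hP
      left
      exact ⟨P.2, mem_univ _, by rw [← hP]⟩
  calc #{P : Edge 3 L | (if p P.1 then P.1.shift P.2 else P.1) = y}
      ≤ #((univ.image fun i : Fin 3 => (y, i)) ∪ (univ.image fun i : Fin 3 => (y - Pi.single i 1, i))) :=
        card_le_card hsub
    _ ≤ #(univ.image fun i : Fin 3 => (y, i)) + #(univ.image fun i : Fin 3 => (y - Pi.single i 1, i)) :=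
        card_union_le _ _
    _ ≤ 3 + 3 := add_le_add (card_image_le.trans (by simp)) (card_image_le.trans (by simp))
    _ = 6 := rfl

/-- `Σ_y #fiber(y) = #plaquettes = 3L³` and hence `Σ_y #fiber(y)² ≤ 18 L³`. [folklore] -/
theorem sum_card_fiber_sq_le :
    (∑ y : Site 3 L, ((#{P : Edge 3 L | (if p P.1 then P.1.shift P.2 else P.1) = y} : ℕ) : ℝ) ^ 2) ≤
      18 * (L : ℝ) ^ 3 := by
  classical
  have hcard : ∑ y : Site 3 L, #{P : Edge 3 L | (if p P.1 then P.1.shift P.2 else P.1) = y} = #(univ : Finset (Edge 3 L)) :=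
    (card_eq_sum_card_fiberwise (f := fun P : Edge 3 L => if p P.1 then P.1.shift P.2 else P.1)
      (s := univ) (t := univ) fun _ _ => mem_coe.2 (mem_univ _)).symm
  have hE : #(univ : Finset (Edge 3 L)) = 3 * L ^ 3 := by
    rw [card_univ, Fintype.card_prod, Fintype.card_pi, Fintype.card_fin]
    simp only [prod_const, card_univ, Fintype.card_fin, ZMod.card]
    ring
  calc (∑ y : Site 3 L, ((#{P : Edge 3 L | (if p P.1 then P.1.shift P.2 else P.1) = y} : ℕ) : ℝ) ^ 2)
      ≤ ∑ y : Site 3 L, 6 * ((#{P : Edge 3 L | (if p P.1 then P.1.shift P.2 else P.1) = y} : ℕ) : ℝ) := by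
        refine sum_le_sum fun y _ => ?_
        have h6 : ((#{P : Edge 3 L | (if p P.1 then P.1.shift P.2 else P.1) = y} : ℕ) : ℝ) ≤ 6 := by
          exact_mod_cast card_fiber_le_six p y
        have h0 : (0 : ℝ) ≤ ((#{P : Edge 3 L | (if p P.1 then P.1.shift P.2 else P.1) = y} : ℕ) : ℝ) :=
          Nat.cast_nonneg _
        nlinarith
    _ = 6 * ((3 * L ^ 3 : ℕ) : ℝ) := by rw [← mul_sum, ← Nat.cast_sum, hcard, hE]
    _ = 18 * (L : ℝ) ^ 3 := by push_cast; ring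

end Bipartite

/-! ## §2 Checkerboard regrouping of the temporal plaquette energy -/

section Regroup

variable {G : Type} [Group G] {n : ℕ} (ρ : G →* Matrix (Fin n) (Fin n) ℂ) {L : ℕ} [NeZero L]
  (U V : GaugeConfig 3 L G) (p : Site 3 L → Prop) [DecidablePred p]

omit [Group G] [NeZero L] in
/-- The split coordinates read back: `(e.symm q) z = q.1 ⟨z, _⟩` on `p`-sites and `q.2 ⟨z, _⟩` on `¬p`-sites, for the
measurable equivalence `e = piEquivPiSubtypeProd` between temporal-link configurations and (odd part, even part).
[folklore] -/
theorem piEquivPiSubtypeProd_symm_apply' [MeasurableSpace G]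
    (q : ({z : Site 3 L // p z} → G) × ({z : Site 3 L // ¬ p z} → G))
    (z : Site 3 L) :
    (MeasurableEquiv.piEquivPiSubtypeProd (fun _ : Site 3 L => G) p).symm q z =
      if h : p z then q.1 ⟨z, h⟩ else q.2 ⟨z, h⟩ := rfl

/-- **CHECKERBOARD REGROUPING of the temporal plaquette energy.**  For a bipartition `p` (`p(x+eᵢ) ↔ ¬p x`) and every
temporal-link configuration `g`: `S_tm(U,g,V) = Σ_{y even} Σ_{P : ev(P) = y} bg_P(g; g_y)`, where the plaquette
`P = (x,i)` has even endpoint `ev(P)` (`x` if `¬p x`, else `x+eᵢ`) and `bg_P(g; a)` is its energy with the even link set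
to `a` and the odd link read from `g`. [folklore] -/
theorem sliceTemporalAction_eq_sum_even (hp : ∀ x i, p (x.shift i) ↔ ¬ p x) (g : Site 3 L → G) :
    sliceTemporalAction ρ U g V =
      ∑ y : {y : Site 3 L // ¬ p y}, ∑ P ∈ univ.filter (fun P : Edge 3 L => (if p P.1 then P.1.shift P.2 else P.1) = y),
        (if p P.1 then ((n : ℝ) - (ρ (g P.1 * V P * (g y)⁻¹ * (U P)⁻¹)).trace.re)
          else ((n : ℝ) - (ρ (g y * V P * (g (P.1.shift P.2))⁻¹ * (U P)⁻¹)).trace.re)) := by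
  classical
  -- the even-endpoint map into the subtype
  set ev : Edge 3 L → {y : Site 3 L // ¬ p y} :=
    fun P => ⟨if p P.1 then P.1.shift P.2 else P.1, exists_evenEnd p hp P⟩ with hev
  have hfib : ∀ (y : {y : Site 3 L // ¬ p y}),
      univ.filter (fun P : Edge 3 L => (if p P.1 then P.1.shift P.2 else P.1) = y) = univ.filter (fun P => ev P = y) := by
    intro y; refine filter_congr fun P _ => ?_
    rw [hev, Subtype.ext_iff]
  have hS : sliceTemporalAction ρ U g V =
      ∑ P : Edge 3 L, ((n : ℝ) - (ρ (g P.1 * V P * (g (P.1.shift P.2))⁻¹ * (U P)⁻¹)).trace.re) := by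
    unfold sliceTemporalAction
    rw [← Fintype.sum_prod_type']
  rw [hS, ← sum_fiberwise univ ev]
  refine sum_congr rfl fun y _ => ?_
  rw [hfib y]
  refine sum_congr rfl fun P hP => ?_
  have hPy : ev P = y := (mem_filter.1 hP).2
  rw [hev, Subtype.ext_iff] at hPy
  simp only at hPy
  by_cases h : p P.1
  · rw [if_pos h] at hPy ⊢; rw [hPy]
  · rw [if_neg h] at hPy ⊢; rw [hPy]

end Regroup

/-! ## §3 One link: Jensen below, Hoeffding above; Haar invariance of the plaquette mean -/

section SingleSite

/-- **Jensen below, Hoeffding above** for a bounded random variable: on a probability space, if `X ∈ [0, B]` a.e. then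
`e^{−β E X} ≤ E e^{−βX} ≤ e^{−β E X}·e^{(B/2)² β²/2}` for every real `β` (Mathlib `ConvexOn.map_integral_le`,
`ProbabilityTheory.hasSubgaussianMGF_of_mem_Icc`). [folklore] -/
theorem exp_neg_mul_integral_le_integral_exp_le {Ω : Type*} [MeasurableSpace Ω] {μ : Measure Ω}
    [IsProbabilityMeasure μ] {X : Ω → ℝ} (hX : AEMeasurable X μ) {B : ℝ} (hB : ∀ᵐ ω ∂μ, X ω ∈ Set.Icc 0 B) (β : ℝ) :
    Real.exp (-(β * ∫ ω, X ω ∂μ)) ≤ ∫ ω, Real.exp (-(β * X ω)) ∂μ ∧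
      ∫ ω, Real.exp (-(β * X ω)) ∂μ ≤ Real.exp (-(β * ∫ ω, X ω ∂μ)) * Real.exp ((B / 2) ^ 2 * β ^ 2 / 2) := by
  have hXi : Integrable X μ := Integrable.of_mem_Icc 0 B hX hB
  have hexp : ∀ t : ℝ, Integrable (fun ω => Real.exp (t * X ω)) μ :=
    fun t => ProbabilityTheory.integrable_exp_mul_of_mem_Icc hX hB
  constructor
  · have hfi : Integrable (fun ω => -(β * X ω)) μ := (hXi.const_mul β).neg
    have hgi : Integrable (Real.exp ∘ fun ω => -(β * X ω)) μ :=
      (hexp (-β)).congr (Eventually.of_forall fun ω => by simp only [comp_apply, neg_mul])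
    have h := (convexOn_exp.map_integral_le Real.continuous_exp.continuousOn isClosed_univ
      (Eventually.of_forall fun ω => Set.mem_univ _) hfi hgi)
    rw [integral_neg, integral_const_mul] at h
    exact h
  · have hsg := ProbabilityTheory.hasSubgaussianMGF_of_mem_Icc (μ := μ) (X := X) (a := 0) (b := B) hX hB
    have hmgf := hsg.mgf_le (-β)
    have hsplit : ∀ ω, Real.exp (-(β * X ω)) =
        Real.exp (-(β * ∫ ω', X ω' ∂μ)) * Real.exp ((-β) * (X ω - ∫ ω', X ω' ∂μ)) :=
      fun ω => by rw [← Real.exp_add]; congr 1; ring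
    have hI : ∫ ω, Real.exp (-(β * X ω)) ∂μ =
        Real.exp (-(β * ∫ ω', X ω' ∂μ)) * ∫ ω, Real.exp ((-β) * (X ω - ∫ ω', X ω' ∂μ)) ∂μ := by
      rw [← integral_const_mul]
      exact integral_congr_ae (Eventually.of_forall hsplit)
    rw [hI]
    refine mul_le_mul_of_nonneg_left ?_ (Real.exp_pos _).le
    have hc : (((‖B - 0‖₊ / 2) ^ 2 : NNReal) : ℝ) * (-β) ^ 2 / 2 = (B / 2) ^ 2 * β ^ 2 / 2 := by
      rw [sub_zero, NNReal.coe_pow, NNReal.coe_div, coe_nnnorm, Real.norm_eq_abs]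
      push_cast
      rw [div_pow, div_pow, sq_abs]
      ring
    have h := hmgf
    rw [ProbabilityTheory.mgf, hc] at h
    exact h

variable {G : Type} [Group G] [TopologicalSpace G] [IsTopologicalGroup G] [CompactSpace G]
  [MeasurableSpace G] [BorelSpace G] {n : ℕ} (ρ : G →* Matrix (Fin n) (Fin n) ℂ)

/-- **One-link Haar invariance, first orientation**: `∫ Re tr ρ(a·c) da = ∫ Re tr ρ(a) da`. [folklore] -/
theorem integral_trace_re_mul_right (c : G) :
    ∫ a, (ρ (a * c)).trace.re ∂haarProbability G = ∫ a, (ρ a).trace.re ∂haarProbability G :=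
  integral_mul_right_eq_self (fun a => (ρ a).trace.re) c

/-- **One-link Haar invariance, second orientation**: `∫ Re tr ρ(c·a⁻¹·d) da = ∫ Re tr ρ(a) da` (cyclicity of the
trace, inversion invariance and left invariance of the Haar probability measure of a compact group). [folklore] -/
theorem integral_trace_re_mul_inv_mul (c d : G) :
    ∫ a, (ρ (c * a⁻¹ * d)).trace.re ∂haarProbability G = ∫ a, (ρ a).trace.re ∂haarProbability G := by
  have h1 : ∀ a : G, (ρ (c * a⁻¹ * d)).trace.re = (ρ (d * c * a⁻¹)).trace.re := fun a => by
    simp only [map_mul]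
    rw [Matrix.trace_mul_comm, ← mul_assoc]
  simp_rw [h1]
  have h2 := integral_inv_eq_self (μ := haarProbability G) (fun a : G => (ρ (d * c * a)).trace.re)
  rw [h2]
  exact integral_mul_left_eq_self (fun a => (ρ a).trace.re) (d * c)

end SingleSite

section SiteTerm

variable {G : Type} [Group G] [TopologicalSpace G] [IsTopologicalGroup G] [CompactSpace G]
  [MeasurableSpace G] [BorelSpace G] {n : ℕ} (ρ : G →* Matrix (Fin n) (Fin n) ℂ) {L : ℕ} [NeZero L]
  (U V : GaugeConfig 3 L G) (p : Site 3 L → Prop) [DecidablePred p]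

omit [NeZero L] in
/-- One plaquette term with the even link free (`a`) and the odd link read from a background `gb`: continuous in `a`,
valued in `[0, 2n]`, and with Haar mean `n − ∫ Re tr ρ` WHATEVER the background, the slices and the orientation
(`integral_trace_re_mul_right`, `integral_trace_re_mul_inv_mul`). [folklore] -/
theorem plaquetteTerm_facts (hρ : Continuous ρ) (hρu : ∀ g, ρ g ∈ Matrix.unitaryGroup (Fin n) ℂ)
    (gb : Site 3 L → G) (P : Edge 3 L) :
    (Continuous fun a : G => if p P.1 then ((n : ℝ) - (ρ (gb P.1 * V P * a⁻¹ * (U P)⁻¹)).trace.re)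
        else ((n : ℝ) - (ρ (a * V P * (gb (P.1.shift P.2))⁻¹ * (U P)⁻¹)).trace.re)) ∧
      (∀ a : G, (if p P.1 then ((n : ℝ) - (ρ (gb P.1 * V P * a⁻¹ * (U P)⁻¹)).trace.re)
        else ((n : ℝ) - (ρ (a * V P * (gb (P.1.shift P.2))⁻¹ * (U P)⁻¹)).trace.re)) ∈ Set.Icc (0 : ℝ) (2 * n)) ∧
      ∫ a, (if p P.1 then ((n : ℝ) - (ρ (gb P.1 * V P * a⁻¹ * (U P)⁻¹)).trace.re)
        else ((n : ℝ) - (ρ (a * V P * (gb (P.1.shift P.2))⁻¹ * (U P)⁻¹)).trace.re)) ∂haarProbability G =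
        (n : ℝ) - ∫ a, (ρ a).trace.re ∂haarProbability G := by
  have htr : Continuous fun g : G => (ρ g).trace.re := Complex.continuous_re.comp (Continuous.matrix_trace hρ)
  have hbd : ∀ h : G, (n : ℝ) - (ρ h).trace.re ∈ Set.Icc (0 : ℝ) (2 * n) := fun h => by
    have h1 := abs_trace_re_le ρ hρu h
    rw [abs_le] at h1
    constructor <;> linarith [h1.1, h1.2]
  have hint : Integrable (fun a : G => (ρ a).trace.re) (haarProbability G) :=
    Integrable.of_bound htr.measurable.aestronglyMeasurable n
      (Eventually.of_forall fun a => by rw [Real.norm_eq_abs]; exact abs_trace_re_le ρ hρu a)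
  by_cases hP : p P.1
  · simp only [if_pos hP]
    refine ⟨continuous_const.sub (htr.comp (((continuous_const.mul continuous_id.inv)).mul continuous_const)),
      fun a => hbd _, ?_⟩
    have hi : Integrable (fun a : G => (ρ (gb P.1 * V P * a⁻¹ * (U P)⁻¹)).trace.re) (haarProbability G) :=
      Integrable.of_bound ((htr.comp (((continuous_const.mul continuous_id.inv)).mul
        continuous_const)).measurable.aestronglyMeasurable) n
        (Eventually.of_forall fun a => by rw [Real.norm_eq_abs]; exact abs_trace_re_le ρ hρu _)
    rw [integral_sub (integrable_const _) hi, integral_const, smul_eq_mul, probReal_univ, one_mul,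
      integral_trace_re_mul_inv_mul ρ (gb P.1 * V P) (U P)⁻¹]
  · simp only [if_neg hP]
    refine ⟨continuous_const.sub (htr.comp (((continuous_id.mul continuous_const).mul continuous_const).mul
      continuous_const)), fun a => hbd _, ?_⟩
    have hi : Integrable (fun a : G => (ρ (a * V P * (gb (P.1.shift P.2))⁻¹ * (U P)⁻¹)).trace.re) (haarProbability G) :=
      Integrable.of_bound ((htr.comp (((continuous_id.mul continuous_const).mul continuous_const).mul
        continuous_const)).measurable.aestronglyMeasurable) n
        (Eventually.of_forall fun a => by rw [Real.norm_eq_abs]; exact abs_trace_re_le ρ hρu _)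
    have hassoc : ∀ a : G, a * V P * (gb (P.1.shift P.2))⁻¹ * (U P)⁻¹ = a * (V P * (gb (P.1.shift P.2))⁻¹ * (U P)⁻¹) :=
      fun a => by group
    simp_rw [hassoc]
    rw [integral_sub (integrable_const _) (by simpa only [hassoc] using hi), integral_const, smul_eq_mul,
      probReal_univ, one_mul, integral_trace_re_mul_right ρ]

/-- **THE SITE TERM: Jensen below, Hoeffding above.**  For a site `y`, a background `gb` and any real `β`, the sum
`F_y(a)` of the `f_y = #fiber(y) ≤ 6` plaquette terms whose even endpoint is `y` (even link `a`, odd links from `gb`)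
satisfies `e^{−β f_y s̄₀} ≤ ∫ e^{−β F_y(a)} da ≤ e^{−β f_y s̄₀}·e^{n² f_y² β²/2}`, `s̄₀ = n − ∫ Re tr ρ`. [folklore] -/
theorem siteTerm_two_sided (hρ : Continuous ρ) (hρu : ∀ g, ρ g ∈ Matrix.unitaryGroup (Fin n) ℂ) (β : ℝ)
    (gb : Site 3 L → G) (y : Site 3 L) :
    Real.exp (-(β * (#{P : Edge 3 L | (if p P.1 then P.1.shift P.2 else P.1) = y} *
        ((n : ℝ) - ∫ a, (ρ a).trace.re ∂haarProbability G)))) ≤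
      ∫ a, Real.exp (-(β * ∑ P ∈ univ.filter (fun P : Edge 3 L => (if p P.1 then P.1.shift P.2 else P.1) = y),
        (if p P.1 then ((n : ℝ) - (ρ (gb P.1 * V P * a⁻¹ * (U P)⁻¹)).trace.re)
          else ((n : ℝ) - (ρ (a * V P * (gb (P.1.shift P.2))⁻¹ * (U P)⁻¹)).trace.re)))) ∂haarProbability G ∧
    ∫ a, Real.exp (-(β * ∑ P ∈ univ.filter (fun P : Edge 3 L => (if p P.1 then P.1.shift P.2 else P.1) = y),
        (if p P.1 then ((n : ℝ) - (ρ (gb P.1 * V P * a⁻¹ * (U P)⁻¹)).trace.re)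
          else ((n : ℝ) - (ρ (a * V P * (gb (P.1.shift P.2))⁻¹ * (U P)⁻¹)).trace.re)))) ∂haarProbability G ≤
      Real.exp (-(β * (#{P : Edge 3 L | (if p P.1 then P.1.shift P.2 else P.1) = y} *
        ((n : ℝ) - ∫ a, (ρ a).trace.re ∂haarProbability G)))) *
        Real.exp (((n : ℝ) * #{P : Edge 3 L | (if p P.1 then P.1.shift P.2 else P.1) = y}) ^ 2 * β ^ 2 / 2) := by
  set fib := univ.filter (fun P : Edge 3 L => (if p P.1 then P.1.shift P.2 else P.1) = y) with hfib
  set X : G → ℝ := fun a => ∑ P ∈ fib, (if p P.1 then ((n : ℝ) - (ρ (gb P.1 * V P * a⁻¹ * (U P)⁻¹)).trace.re)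
    else ((n : ℝ) - (ρ (a * V P * (gb (P.1.shift P.2))⁻¹ * (U P)⁻¹)).trace.re)) with hX
  have hfacts := fun P => plaquetteTerm_facts ρ U V p hρ hρu gb P
  have hXc : Continuous X := continuous_finsetSum _ fun P _ => (hfacts P).1
  have hXm : AEMeasurable X (haarProbability G) := hXc.measurable.aemeasurable
  have hXb : ∀ᵐ a ∂haarProbability G, X a ∈ Set.Icc (0 : ℝ) (2 * n * #fib) := Eventually.of_forall fun a => by
    constructor
    · exact sum_nonneg fun P _ => ((hfacts P).2.1 a).1
    · have h := sum_le_card_nsmul fib _ (2 * (n : ℝ)) fun P _ => ((hfacts P).2.1 a).2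
      rw [nsmul_eq_mul] at h
      linarith
  have hXint : ∫ a, X a ∂haarProbability G = #fib * ((n : ℝ) - ∫ a, (ρ a).trace.re ∂haarProbability G) := by
    rw [hX, integral_finsetSum _ fun P _ => ?_]
    · rw [sum_congr rfl fun P _ => (hfacts P).2.2, sum_const, nsmul_eq_mul]
    · exact Integrable.of_mem_Icc 0 (2 * n) (hfacts P).1.measurable.aemeasurable
        (Eventually.of_forall (hfacts P).2.1)
  have h := exp_neg_mul_integral_le_integral_exp_le (μ := haarProbability G) hXm hXb β
  rw [hXint] at h
  have hc : (2 * (n : ℝ) * #fib / 2) ^ 2 = ((n : ℝ) * #fib) ^ 2 := by ring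
  rw [hc] at h
  exact h

end SiteTerm

end Summit.QuantumFields.YangMills.Cruxes.IR.ColdPurityGaussLaw

end
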